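import Mathlib
import HarnessLib
import Summits.NavierStokesRegularity.NavierStokesRegularity.Theorems.TypeIQuarterGateScarEnvelopeTypeIForcedTsaiAlgSound
import Summits.NavierStokesRegularity.NavierStokesRegularity.Theorems.TypeIQuarterGateScarEnvelopeTypeIForcedTsaiAlgWitnessL1T3

/-!
# ARM B lane E-exact — LANEX-ALG table `L1T3` AS TREE THEOREMS: `ForcedTsaiModulusLE M δ` per row

Per-row closers of the kernel-checked Type-I-tail witness table `algTableL1T3` (`…AlgWitnessL1T3`,
`native_decide`) through the soundness theorem `AlgRow.sound` (`…AlgSound`): certified UPPER bounds on the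
forced-Tsai modulus in the tree currency (`ℝ³`, weight `(1+ρ)⁵`):
`δ*(¼) ≤ 4.2506` (δ/M = 17.00), `δ*(½) ≤ 8.5212` (17.04), `δ*(1) ≤ 17.2038` (17.20), `δ*(2) ≤ 35.5582`
(17.78), `δ*(4) ≤ 79.6739` (19.92) — vs `≈ 40·M` for the polynomial × Gaussian class (`…WitnessW5T0*`).
«Near-profiles this good EXIST»; excludes nothing; nothing about NS regularity; 23843 / H3 OPEN.
-/

set_option linter.dupNamespace false

namespace Summit.NavierStokesRegularity.NavierStokesRegularity.Cruxes.ScarEnvelopeTypeI.ForcedTsai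

/-- Every row of `algTableL1T3` certifies its `ForcedTsaiModulusLE M δ`. -/
theorem algTableL1T3_sound : ∀ r ∈ algTableL1T3, ForcedTsaiModulusLE (r.M : ℝ) (r.δ : ℝ) :=
  AlgTable.sound _ algTableL1T3_check

/-- `δ*(1/4) ≤ 21253/5000 = 4.2506` (Type-I-tail class, δ/M = 17.00). -/
theorem forcedTsaiModulusLE_alg_quarter : ForcedTsaiModulusLE (1 / 4 : ℝ) (21253 / 5000 : ℝ) := by
  have h := algRowL1T3r0.sound (by native_decide)
  norm_num [algRowL1T3r0] at h
  exact h

/-- `δ*(1/2) ≤ 21303/2500 = 8.5212` (δ/M = 17.04). -/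
theorem forcedTsaiModulusLE_alg_half : ForcedTsaiModulusLE (1 / 2 : ℝ) (21303 / 2500 : ℝ) := by
  have h := algRowL1T3r1.sound (by native_decide)
  norm_num [algRowL1T3r1] at h
  exact h

/-- `δ*(1) ≤ 86019/5000 = 17.2038` (δ/M = 17.20). -/
theorem forcedTsaiModulusLE_alg_one : ForcedTsaiModulusLE (1 : ℝ) (86019 / 5000 : ℝ) := by
  have h := algRowL1T3r2.sound (by native_decide)
  norm_num [algRowL1T3r2] at h
  exact h

/-- `δ*(2) ≤ 177791/5000 = 35.5582` (δ/M = 17.78). -/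
theorem forcedTsaiModulusLE_alg_two : ForcedTsaiModulusLE (2 : ℝ) (177791 / 5000 : ℝ) := by
  have h := algRowL1T3r3.sound (by native_decide)
  norm_num [algRowL1T3r3] at h
  exact h

/-- `δ*(4) ≤ 796739/10000 = 79.6739` (δ/M = 19.92). -/
theorem forcedTsaiModulusLE_alg_four : ForcedTsaiModulusLE (4 : ℝ) (796739 / 10000 : ℝ) := by
  have h := algRowL1T3r4.sound (by native_decide)
  norm_num [algRowL1T3r4] at h
  exact h

/-- Rounded: `ForcedTsaiModulusLE 1 (69/4)` (`δ/M ≤ 17.25` at level `1`, Type-I-tail class). -/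
theorem forcedTsaiModulusLE_1_17q : ForcedTsaiModulusLE (1 : ℝ) (69 / 4 : ℝ) :=
  forcedTsaiModulusLE_alg_one.mono le_rfl (by norm_num)

end Summit.NavierStokesRegularity.NavierStokesRegularity.Cruxes.ScarEnvelopeTypeI.ForcedTsai
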